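import Literature.MathematicalPhysics.QuantumManyBody.BoseGasThermodynamicLimitRuelle
import Literature.MathematicalPhysics.QuantumManyBody.BoseGasDirichletMonotonicity
import Literature.MathematicalPhysics.QuantumManyBody.LiebYngvasonPoincare
import HarnessLib

/-!
# The Dirichlet wall: periodic versus Dirichlet ground-state energies of the SAME box differ strictly

Topic `Literature/MathematicalPhysics/QuantumManyBody` (negative knowledge filed by the crux disprover
of `PeriodicToDirichlet`, stmt-AtomisticToContinuum-9483 = the global form of stmt-0827
`BoundaryTransferWeak`: "periodic-box BEC ⇒ Dirichlet-box BEC"). Elementary facts over the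
vocabulary of `BoseEinsteinCondensation.lean` / `PeriodicBoseGas.lean` /
`BoseGasThermodynamicLimitProofs.lean` (`TrialState.toPeriodic`):

* `dirichlet_wall_energy_one`, `dirichlet_wall` — **the Dirichlet wall**: `E₀^D(v, N, L) ≥ π²/(8L²)`
  for all `N ≥ 1`, `L > 0`, measurable `v ≥ 0`. Proof: the Neumann Poincaré inequality of the tree
  (`Poincare.poincare_boxN`, gap `π²/ℓ²`) on the DOUBLED box `Λ_{2L}`, in which a Dirichlet state
  of `Λ_L` occupies one octant and is therefore at squared `L²`-distance `≥ 1/2` from the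
  constants; then particle monotonicity `groundStateEnergy_mono_particles`. (Sharp: `3π²N/L²` for
  `v = 0`.)
* `periodicGroundStateEnergy_zero_eq_zero` — `E₀^per(0, N, L) = 0` (constant state), hence
  `periodicGroundStateEnergy_lt_groundStateEnergy_zero`: `E₀^per(0,N,L) < E₀^D(0,N,L)` strictly.
* `energy_le_periodicEnergy_toPeriodic` — periodising a Dirichlet state never lowers its energy
  (any `v ≥ 0`; with `TrialState.periodicEnergy_toPeriodic_le` an equality once `L ≥ L₀ + R₀`).
* `statewise_fails`, `not_statewiseTransfer`, `not_statewiseTransferEventually` — **state-wise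
  boundary-condition transfer is false**: for `v = 0`, every `N ≥ 1` and every `L > 0` (so also
  along `L_N = (N/ρ)^{1/3}` at every density, for every `N`) there are a slack `δ > 0` and a
  Dirichlet `δ`-near-minimiser whose periodisation is NOT a periodic `δ`-near-minimiser of the
  torus of the same side (its periodic energy exceeds `E₀^per + δ`).
* `dirichlet_wall_linear`, `dirichlet_wall_thermodynamic` (added 2026-08-15, same author) — the
  wall is EXTENSIVE: `E₀^D(v, N, L) ≥ N·π²/(8L²)` by superadditivity in the particle number
  (`groundStateEnergy_superadditive`); along `L_N = (N/ρ)^{1/3}` this is `(π²/8)ρL_N → ∞`, the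
  order `N/L_N²` of one kinetic gap per particle.

Why it is recorded: statements of the form "periodic ground-state BEC (for `δ`-near-minimisers,
`∃ δ > 0` after `N`) ⇒ Dirichlet ground-state BEC" (stmt-0827, stmt-9483 and every periodic-first
BEC route) cannot be proved by periodising Dirichlet near-ground states and invoking the periodic
hypothesis on them — the hypothesis never fires, at any `N`. (The complementary fact — that no
WINDOWED periodic hypothesis wide enough to contain the wall can be true — is the Galilei-boost
content of `Literature.Barriers.AtomisticToContinuum.KineticGapLengthScalesNarrow`.) No new
definitions; `[folklore]` throughout.

## References

* [LSSY2005] E. H. Lieb, R. Seiringer, J. P. Solovej, J. Yngvason, *The Mathematics of the Bose Gas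
  and its Condensation* (2005), Ch. 2, after (2.2) ("Dirichlet boundary conditions … lead … to the
  highest energies") — the qualitative statement; the quantitative wall `π²/(8L²)` is folklore
  (Dirichlet Laplacian of a cube).
-/

noncomputable section

namespace Literature.MathematicalPhysics.QuantumManyBody.BoseGas

open _root_.MeasureTheory _root_.Filter _root_.Topology
open scoped ENNReal NNReal

variable {N : ℕ} {L₀ L : ℝ}

/-- For the free gas (`v ≡ 0`) the periodised interaction vanishes identically. [folklore] -/
theorem periodicInteraction_zeroPotential (L : ℝ) (X : Config N) :
    periodicInteraction (0 : ℝ → ℝ≥0∞) L X = 0 := by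
  simp [periodicInteraction, periodizedPotential]

/-- `E₀^per(v ≡ 0, N, L) = 0` for every `N` and `L > 0`: the constant state `L^{-3N/2}` is an
admissible periodic trial state with zero energy. [folklore] -/
theorem periodicGroundStateEnergy_zero_eq_zero (N : ℕ) (hL : 0 < L) :
    periodicGroundStateEnergy (0 : ℝ → ℝ≥0∞) N L = 0 := by
  have hL3 : 0 < L ^ 3 := by positivity
  have hc : ((‖(((Real.sqrt (L ^ 3))⁻¹ ^ N : ℝ) : ℂ)‖₊ : ℝ≥0∞) ^ 2) =
      ENNReal.ofReal (((L ^ 3)⁻¹) ^ N) := by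
    rw [← ENNReal.coe_pow, ENNReal.ofReal, ENNReal.coe_inj]
    ext
    rw [NNReal.coe_pow, coe_nnnorm, Complex.norm_real, Real.norm_of_nonneg (by positivity),
      ← pow_mul, mul_comm, pow_mul, inv_pow, Real.sq_sqrt hL3.le,
      Real.coe_toNNReal _ (by positivity)]
  -- the constant state
  let Φ : PeriodicTrialState N L :=
    { ψ := fun _ => (((Real.sqrt (L ^ 3))⁻¹ ^ N : ℝ) : ℂ)
      contDiff := contDiff_const
      periodic := fun _ _ _ => rfl
      symm := fun _ _ => rfl
      norm_eq := by
        rw [setLIntegral_const, volume_cellN, hc, ← ENNReal.ofReal_pow hL.le,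
          ← ENNReal.ofReal_pow (by positivity), ← ENNReal.ofReal_mul (by positivity), ← mul_pow,
          inv_mul_cancel₀ hL3.ne', one_pow, ENNReal.ofReal_one] }
  refine le_antisymm ((periodicGroundStateEnergy_le 0 Φ).trans (le_of_eq ?_)) bot_le
  refine (lintegral_congr fun X => ?_).trans lintegral_zero
  rw [periodicInteraction_zeroPotential, zero_mul, add_zero]
  simp [kineticDensity, Φ]

/-- `‖a‖² ≤ 2‖a - b‖² + 2‖b‖²` in `ℝ≥0∞`. [folklore] -/
theorem ennnorm_sq_le_two_mul (a b : ℂ) :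
    ((‖a‖₊ : ℝ≥0∞) ^ 2) ≤ 2 * (‖a - b‖₊ : ℝ≥0∞) ^ 2 + 2 * (‖b‖₊ : ℝ≥0∞) ^ 2 := by
  have h1 : ‖a‖ ≤ ‖a - b‖ + ‖b‖ := by simpa using norm_add_le (a - b) b
  have h3 : ‖a‖ ^ 2 ≤ (‖a - b‖ + ‖b‖) ^ 2 := pow_le_pow_left₀ (norm_nonneg a) h1 2
  have h2 : ‖a‖ ^ 2 ≤ 2 * ‖a - b‖ ^ 2 + 2 * ‖b‖ ^ 2 := by
    nlinarith [sq_nonneg (‖a - b‖ - ‖b‖), h3]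
  rw [← Poincare.ofReal_norm_sq, ← Poincare.ofReal_norm_sq, ← Poincare.ofReal_norm_sq,
    ← ENNReal.ofReal_ofNat 2, ← ENNReal.ofReal_mul (by norm_num),
    ← ENNReal.ofReal_mul (by norm_num), ← ENNReal.ofReal_add (by positivity) (by positivity)]
  exact ENNReal.ofReal_le_ofReal h2

/-- `|Λ_ℓ^1| = ℓ³`. [folklore] -/
theorem volume_boxN_one (ℓ : ℝ) : volume (boxN 1 ℓ) = ENNReal.ofReal ℓ ^ 3 := by
  rw [measure_congr (boxN_ae_eq_cellN 1 ℓ), volume_cellN, pow_one]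

/-- **The Dirichlet wall, one particle.** Every Dirichlet trial state of one particle in `Λ_L`
has energy `≥ π²/(8L²)`, for any pair profile `v` (a single particle does not interact). Proof:
the Neumann Poincaré inequality `poincare_boxN` (gap `π²/(2L)²`) on the doubled box `Λ_{2L}`, in
which the state occupies one octant and therefore has squared `L²`-distance `≥ 1/2` from the
constants. (Sharp value: `3π²/L²`.) [folklore] -/
theorem dirichlet_wall_energy_one (hL : 0 < L) (v : ℝ → ℝ≥0∞) (Ψ : TrialState 1 L) :
    ENNReal.ofReal (Real.pi ^ 2 / (8 * L ^ 2)) ≤ energy v Ψ := by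
  set ψ := Ψ.ψ with hψdef
  have h2L : 0 < 2 * L := by positivity
  set c : ℂ := ⨍ Y in boxN 1 (2 * L), ψ Y with hc
  set f : Config 1 → ℝ≥0∞ := fun X => (‖ψ X - c‖₊ : ℝ≥0∞) ^ 2 with hf
  -- Poincaré on the doubled box
  have hP := Poincare.poincare_boxN 1 (2 * L) h2L ψ Ψ.contDiff
  -- kinetic energy on the doubled box is at most the energy
  have hkin : ∫⁻ X in boxN 1 (2 * L), kineticDensity ψ X ≤ energy v Ψ :=
    (setLIntegral_le_lintegral _ _).trans (lintegral_mono fun X => le_self_add)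
  -- the state lives in `Λ_L`: normalisation on the small box
  have hsupp : Function.support (fun X => (‖ψ X‖₊ : ℝ≥0∞) ^ 2) ⊆ boxN 1 L := by
    intro X hX
    by_contra h
    exact hX (by simp [hψdef, Ψ.eq_zero X h])
  have h1 : ∫⁻ X in boxN 1 L, (‖ψ X‖₊ : ℝ≥0∞) ^ 2 = 1 := by
    rw [setLIntegral_eq_of_support_subset hsupp]; exact Ψ.norm_eq
  -- measurability
  have hmL : MeasurableSet (boxN 1 L) := measurableSet_boxN 1 L
  have hm2L : MeasurableSet (boxN 1 (2 * L)) := measurableSet_boxN 1 (2 * L)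
  have hfm : Measurable f :=
    ((Ψ.contDiff.continuous.sub continuous_const).measurable.nnnorm.coe_nnreal_ennreal).pow_const 2
  -- pointwise `‖ψ‖² ≤ 2 f + 2‖c‖²`, integrated over the small box
  have h2 : (1 : ℝ≥0∞) ≤ 2 * (∫⁻ X in boxN 1 L, f X) +
      2 * ((‖c‖₊ : ℝ≥0∞) ^ 2 * volume (boxN 1 L)) := by
    calc (1 : ℝ≥0∞) = ∫⁻ X in boxN 1 L, (‖ψ X‖₊ : ℝ≥0∞) ^ 2 := h1.symm
      _ ≤ ∫⁻ X in boxN 1 L, (2 * f X + 2 * (‖c‖₊ : ℝ≥0∞) ^ 2) :=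
          lintegral_mono fun X => ennnorm_sq_le_two_mul (ψ X) c
      _ = 2 * (∫⁻ X in boxN 1 L, f X) + 2 * ((‖c‖₊ : ℝ≥0∞) ^ 2 * volume (boxN 1 L)) := by
          rw [lintegral_add_left (hfm.const_mul _), lintegral_const_mul _ hfm,
            lintegral_const_mul _ measurable_const, setLIntegral_const]
  -- on the shell `S = Λ_{2L} \ Λ_L` the state vanishes, so `∫_S f = ‖c‖² |S| ≥ ‖c‖² |Λ_L|`
  set S := boxN 1 (2 * L) \ boxN 1 L with hS
  have hsub : boxN 1 L ⊆ boxN 1 (2 * L) := boxN_subset_boxN (by linarith)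
  have hmS : MeasurableSet S := hm2L.diff hmL
  have hvolS : volume (boxN 1 L) ≤ volume S := by
    rw [hS, measure_sdiff hsub hmL.nullMeasurableSet (volume_boxN_lt_top 1 L).ne,
      volume_boxN_one, volume_boxN_one, ENNReal.ofReal_mul (by norm_num), mul_pow,
      ENNReal.ofReal_ofNat]
    refine ENNReal.le_sub_of_add_le_right (ENNReal.pow_ne_top ENNReal.ofReal_ne_top) ?_
    rw [← two_mul]
    gcongr
    norm_num
  have h3 : (‖c‖₊ : ℝ≥0∞) ^ 2 * volume (boxN 1 L) ≤ ∫⁻ X in S, f X := by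
    calc (‖c‖₊ : ℝ≥0∞) ^ 2 * volume (boxN 1 L) ≤ (‖c‖₊ : ℝ≥0∞) ^ 2 * volume S := by gcongr
      _ = ∫⁻ _ in S, (‖c‖₊ : ℝ≥0∞) ^ 2 := (setLIntegral_const _ _).symm
      _ = ∫⁻ X in S, f X := by
          refine setLIntegral_congr_fun hmS fun X hX => ?_
          simp [hf, hψdef, Ψ.eq_zero X hX.2]
  -- `∫_{Λ_L} f + ∫_S f = ∫_{Λ_{2L}} f`
  have h4 : (∫⁻ X in boxN 1 L, f X) + (∫⁻ X in S, f X) = ∫⁻ X in boxN 1 (2 * L), f X := by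
    rw [← lintegral_union hmS Set.disjoint_sdiff_right, Set.union_sdiff_cancel hsub]
  -- combine: `1 ≤ 2 ∫_{Λ_{2L}} f`
  have hhalf : (1 : ℝ≥0∞) ≤ 2 * ∫⁻ X in boxN 1 (2 * L), f X := by
    calc (1 : ℝ≥0∞)
        ≤ 2 * (∫⁻ X in boxN 1 L, f X) + 2 * ((‖c‖₊ : ℝ≥0∞) ^ 2 * volume (boxN 1 L)) := h2
      _ ≤ 2 * (∫⁻ X in boxN 1 L, f X) + 2 * (∫⁻ X in S, f X) := by gcongr
      _ = 2 * ∫⁻ X in boxN 1 (2 * L), f X := by rw [← mul_add, h4]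
  have hkey : ENNReal.ofReal (Real.pi ^ 2 / (2 * L) ^ 2) ≤ 2 * energy v Ψ := by
    calc ENNReal.ofReal (Real.pi ^ 2 / (2 * L) ^ 2)
        = ENNReal.ofReal (Real.pi ^ 2 / (2 * L) ^ 2) * 1 := (mul_one _).symm
      _ ≤ ENNReal.ofReal (Real.pi ^ 2 / (2 * L) ^ 2) * (2 * ∫⁻ X in boxN 1 (2 * L), f X) := by
          gcongr
      _ = 2 * (ENNReal.ofReal (Real.pi ^ 2 / (2 * L) ^ 2) * ∫⁻ X in boxN 1 (2 * L), f X) := by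
          ring
      _ ≤ 2 * energy v Ψ := by gcongr; exact hP.trans hkin
  have h8 : ENNReal.ofReal (Real.pi ^ 2 / (8 * L ^ 2)) =
      ENNReal.ofReal (Real.pi ^ 2 / (2 * L) ^ 2) / 2 := by
    rw [← ENNReal.ofReal_ofNat 2, ← ENNReal.ofReal_div_of_pos (by norm_num : (0:ℝ) < 2)]
    congr 1
    field_simp
    ring
  rw [h8]
  exact ENNReal.div_le_of_le_mul' hkey

/-- **The Dirichlet wall**: `E₀^D(v, N, L) ≥ π²/(8L²)` for every `N ≥ 1`, `L > 0` and every
measurable `v ≥ 0` (one particle already pays it; adding particles never lowers the Dirichlet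
energy, `groundStateEnergy_mono_particles`). [folklore] -/
theorem dirichlet_wall {v : ℝ → ℝ≥0∞} (hv : Measurable v) (hL : 0 < L) (hN : 1 ≤ N) :
    ENNReal.ofReal (Real.pi ^ 2 / (8 * L ^ 2)) ≤ groundStateEnergy v N L :=
  (le_iInf fun Ψ => dirichlet_wall_energy_one hL v Ψ).trans
    (groundStateEnergy_mono_particles hv L hN)

/-- **Strict gap between the boundary conditions, free gas**:
`E₀^per(0, N, L) = 0 < π²/(8L²) ≤ E₀^D(0, N, L)` for `N ≥ 1`, `L > 0`. [folklore] -/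
theorem periodicGroundStateEnergy_lt_groundStateEnergy_zero (hL : 0 < L) (hN : 1 ≤ N) :
    periodicGroundStateEnergy (0 : ℝ → ℝ≥0∞) N L < groundStateEnergy (0 : ℝ → ℝ≥0∞) N L := by
  rw [periodicGroundStateEnergy_zero_eq_zero N hL]
  refine lt_of_lt_of_le ?_ (dirichlet_wall measurable_const hL hN)
  rw [ENNReal.ofReal_pos]
  positivity

/-- **Periodising never lowers the energy** (any `v ≥ 0`, any torus side `L ≥ L₀`): on the box the
periodisation `TrialState.toPeriodic` has the same gradient and modulus and `v ≤ v^per`; off the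
box the Dirichlet state and its gradient vanish. (With the tree's
`TrialState.periodicEnergy_toPeriodic_le` this is an equality once `L ≥ L₀ + R₀`.) [folklore] -/
theorem energy_le_periodicEnergy_toPeriodic (v : ℝ → ℝ≥0∞) (Ψ : TrialState N L₀) (hL : 0 < L)
    (hL₀ : L₀ ≤ L) : energy v Ψ ≤ periodicEnergy v (Ψ.toPeriodic hL hL₀) := by
  have hsupp : Function.support
      (fun X => kineticDensity Ψ.ψ X + interaction v X * (‖Ψ.ψ X‖₊ : ℝ≥0∞) ^ 2) ⊆ boxN N L₀ := by
    intro X hX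
    by_contra h
    apply hX
    simp [kineticDensity, Ψ.fderiv_eq_zero h, Ψ.eq_zero X h]
  unfold energy periodicEnergy
  rw [← setLIntegral_eq_of_support_subset hsupp]
  calc ∫⁻ X in boxN N L₀, kineticDensity Ψ.ψ X + interaction v X * (‖Ψ.ψ X‖₊ : ℝ≥0∞) ^ 2
      ≤ ∫⁻ X in boxN N L₀, kineticDensity (Ψ.toPeriodic hL hL₀).ψ X +
          periodicInteraction v L X * (‖(Ψ.toPeriodic hL hL₀).ψ X‖₊ : ℝ≥0∞) ^ 2 := by
        refine setLIntegral_mono' (measurableSet_boxN N L₀) fun X hX => ?_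
        have hXL : X ∈ boxN N L := boxN_subset_boxN hL₀ hX
        show _ ≤ kineticDensity (periodize L Ψ.ψ) X +
          periodicInteraction v L X * (‖periodize L Ψ.ψ X‖₊ : ℝ≥0∞) ^ 2
        rw [kineticDensity_periodize_of_mem_boxN hL Ψ.ψ hXL,
          periodize_of_mem_cellN hL Ψ.ψ (boxN_subset_cellN le_rfl hXL)]
        gcongr
        exact interaction_le_periodicInteraction v L X
    _ ≤ _ := lintegral_mono_set (boxN_subset_cellN hL₀)

/-- Positivity of the thermodynamic side length `L_N = (N/ρ)^{1/3}` (`ρ > 0`, `N ≥ 1`). [folklore] -/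
theorem sideLength_pos_of_pos {ρ : ℝ} (hρ : 0 < ρ) (hN : 0 < N) : 0 < sideLength ρ N :=
  Real.rpow_pos_of_pos (div_pos (Nat.cast_pos.2 hN) hρ) _

/-- **State-wise transfer fails in every box** (free gas, `N ≥ 1`, `L > 0`): there are a slack
`δ > 0` and a Dirichlet `δ`-near-minimiser whose periodisation is NOT a periodic
`δ`-near-minimiser of the torus of the same side — its periodic energy exceeds `E₀^per + δ`.
[folklore] -/
theorem statewise_fails (hL : 0 < L) (hN : 0 < N) :
    ∃ δ : ℝ≥0∞, 0 < δ ∧ ∃ Ψ : TrialState N L,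
      energy 0 Ψ ≤ groundStateEnergy 0 N L + δ ∧
        periodicGroundStateEnergy 0 N L + δ < periodicEnergy 0 (Ψ.toPeriodic hL le_rfl) := by
  set δ : ℝ≥0∞ := ENNReal.ofReal (Real.pi ^ 2 / (16 * L ^ 2)) with hδ
  have hδ0 : 0 < δ := by rw [hδ, ENNReal.ofReal_pos]; positivity
  have htop : groundStateEnergy (0 : ℝ → ℝ≥0∞) N L < ⊤ :=
    groundStateEnergy_lt_top_of_lintegral_ne_top' measurable_const (by simp) hL hN
  have hlt : groundStateEnergy (0 : ℝ → ℝ≥0∞) N L < groundStateEnergy 0 N L + δ :=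
    ENNReal.lt_add_right htop.ne hδ0.ne'
  obtain ⟨Ψ, hΨ⟩ := iInf_lt_iff.mp hlt
  refine ⟨δ, hδ0, Ψ, hΨ.le, ?_⟩
  rw [periodicGroundStateEnergy_zero_eq_zero N hL, zero_add]
  have hwall := dirichlet_wall (v := (0 : ℝ → ℝ≥0∞)) measurable_const hL (Nat.one_le_of_lt hN)
  calc δ < ENNReal.ofReal (Real.pi ^ 2 / (8 * L ^ 2)) := by
        rw [hδ, ENNReal.ofReal_lt_ofReal_iff (by positivity)]
        have hπ : 0 < Real.pi ^ 2 / L ^ 2 := by positivity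
        rw [div_mul_eq_div_div_swap, div_mul_eq_div_div_swap]
        linarith
    _ ≤ groundStateEnergy 0 N L := hwall
    _ ≤ energy 0 Ψ := groundStateEnergy_le_energy 0 Ψ
    _ ≤ _ := energy_le_periodicEnergy_toPeriodic 0 Ψ hL le_rfl

/-- **State-wise transfer is false**: it is NOT the case that for every admissible `v`, box
`L > 0`, particle number `N` and slack `δ > 0`, periodising a Dirichlet `δ`-near-minimiser of
`Λ_L` yields a periodic `δ`-near-minimiser of the torus of side `L` (witness: `v = 0`, one
particle, unit box). This is the step a direct use of the antecedent `PeriodicBEC` of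
`PeriodicToDirichlet` / of stmt-0827 on Dirichlet near-ground states would need. [folklore] -/
theorem not_statewiseTransfer :
    ¬ (∀ v : ℝ → ℝ≥0∞, IsRepulsiveFiniteRange v →
        ∀ (N : ℕ) (L : ℝ) (hL : 0 < L) (δ : ℝ≥0∞), 0 < δ →
          ∀ Ψ : TrialState N L, energy v Ψ ≤ groundStateEnergy v N L + δ →
            periodicEnergy v (Ψ.toPeriodic hL le_rfl) ≤ periodicGroundStateEnergy v N L + δ) := by
  intro h
  obtain ⟨δ, hδ, Ψ, hΨ, hlt⟩ := statewise_fails (N := 1) (L := 1) one_pos one_pos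
  exact absurd hlt (not_lt.2 (h 0 ⟨measurable_const, 0, fun _ _ => rfl⟩ 1 1 one_pos δ hδ Ψ hΨ))

/-- **State-wise transfer is false along the thermodynamic box sequence too**: even restricted to
`L_N = (N/ρ)^{1/3}` and to large `N`, the state-wise transfer fails (witness `v = 0`, any density;
in fact it fails at EVERY `N ≥ 1`). [folklore] -/
theorem not_statewiseTransferEventually :
    ¬ (∀ v : ℝ → ℝ≥0∞, IsRepulsiveFiniteRange v → ∀ ρ : ℝ, 0 < ρ → ∀ᶠ N : ℕ in atTop,
        ∀ (hL : 0 < sideLength ρ N) (δ : ℝ≥0∞), 0 < δ →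
          ∀ Ψ : TrialState N (sideLength ρ N),
            energy v Ψ ≤ groundStateEnergy v N (sideLength ρ N) + δ →
              periodicEnergy v (Ψ.toPeriodic hL le_rfl) ≤
                periodicGroundStateEnergy v N (sideLength ρ N) + δ) := by
  intro h
  have hev := h 0 ⟨measurable_const, 0, fun _ _ => rfl⟩ 1 one_pos
  obtain ⟨N, hN, hN'⟩ := ((eventually_gt_atTop 0).and hev).exists
  have hL : 0 < sideLength 1 N := sideLength_pos_of_pos one_pos hN
  obtain ⟨δ, hδ, Ψ, hΨ, hlt⟩ := statewise_fails hL hN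
  exact absurd hlt (not_lt.2 (hN' hL δ hδ Ψ hΨ))

/-- **The Dirichlet wall is extensive**: `E₀^D(v, N, L) ≥ N · π²/(8L²)` for every `N`, `L > 0`
and measurable `v ≥ 0` — each particle pays the one-particle wall, by superadditivity of the
Dirichlet energy in the particle number (`groundStateEnergy_superadditive`). Along
`L_N = (N/ρ)^{1/3}` this is `(π²/8) ρ L_N · 1 = (π²/8)ρ^{2/3}N^{1/3} → ∞`, the order `N/L_N²` of
one kinetic gap per particle. [folklore] -/
theorem dirichlet_wall_linear {v : ℝ → ℝ≥0∞} (hv : Measurable v) (hL : 0 < L) (N : ℕ) :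
    ENNReal.ofReal (N * (Real.pi ^ 2 / (8 * L ^ 2))) ≤ groundStateEnergy v N L := by
  induction N with
  | zero => simp
  | succ n ih =>
    calc ENNReal.ofReal (((n + 1 : ℕ) : ℝ) * (Real.pi ^ 2 / (8 * L ^ 2)))
        = ENNReal.ofReal (n * (Real.pi ^ 2 / (8 * L ^ 2))) +
            ENNReal.ofReal (Real.pi ^ 2 / (8 * L ^ 2)) := by
          rw [← ENNReal.ofReal_add (by positivity) (by positivity)]
          congr 1
          push_cast
          ring
      _ ≤ groundStateEnergy v n L + groundStateEnergy v 1 L :=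
          add_le_add ih (dirichlet_wall hv hL le_rfl)
      _ ≤ groundStateEnergy v (n + 1) L := groundStateEnergy_superadditive hv n 1 L

/-- The extensive wall along the thermodynamic box sequence: `E₀^D(v, N, L_N) ≥ (π²/8) ρ L_N`
(`N ≥ 1`, `ρ > 0`; `N/L_N² = ρ L_N`). [folklore] -/
theorem dirichlet_wall_thermodynamic {v : ℝ → ℝ≥0∞} (hv : Measurable v) {ρ : ℝ} (hρ : 0 < ρ)
    (hN : 0 < N) :
    ENNReal.ofReal (Real.pi ^ 2 / 8 * ρ * sideLength ρ N) ≤ groundStateEnergy v N (sideLength ρ N) := by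
  have hL : 0 < sideLength ρ N := sideLength_pos_of_pos hρ hN
  have h3 := div_sideLength_pow_three hρ hN
  rw [div_eq_iff (by positivity)] at h3
  convert dirichlet_wall_linear hv hL N using 2
  rw [h3]
  field_simp

end Literature.MathematicalPhysics.QuantumManyBody.BoseGas

end
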